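import Literature.MathematicalPhysics.KineticTheory.LambertianHardSphereFlow
import Literature.MathematicalPhysics.KineticTheory.HardSphereEulerProofs
import Summits.AtomisticToContinuum.HydrodynamicLimit.Theorems.OneFlightGossipEngineEnergyCurrentTailsPedigreeDataTails
import Summits.AtomisticToContinuum.HydrodynamicLimit.Theorems.JParityClosureParityInBandEnergyTight
import HarnessLib

/-!
# `SwapGap` (stmt-AtomisticToContinuum-11850), line `Sketch`, stub T9: exponential energy tightness of the Lambertian gas

Helper file of the line `Sketch` for the crux
`Summit.AtomisticToContinuum.HydrodynamicLimit.Theses.LambertianContactSwap.SwapGap`: the registered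
interface stub T9 `stub_energyTightnessLambda` — ingredient (i), exponential tightness, of any
large-deviation upper bound for the Lambertian hard-sphere gas `Λ` (`lambertFlow` driven by the i.i.d.
Gaussian marks `lambertNoise`, started from the local Gibbs law `P_N = localGibbsLaw σ a₀ u₀ θ₀ N Φ`).
For continuous profiles (`a₀, θ₀ > 0`), `0 < σ < 1/2` and EVERY rate `M > 0` there are `K` and `C > 0`
with `(P_N ⊗ γ^ℕ){K < e_1(Λ_t p)} ≤ C e^{−M(N+1)}` for all `N`, all flows `Φ` and all real `t`, where
`e_1 = empiricalEnergyField · 1 = (N+1)⁻¹ · ½∑ᵢ‖vᵢ‖²` is the kinetic energy per particle.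

Proof.  (1) The kinetic energy does not increase along `Λ` (`configEnergy_lambertFlow_le`, every noise
sequence, every `t`), so the event lies in the cylinder `{ē(N+1) + x ≤ ∑ᵢ‖vᵢ‖²} ×ˢ univ` over the
datum as soon as `2K ≥ ē + x/(N+1)`, and `(P_N ⊗ γ^ℕ)(A ×ˢ univ) ≤ P_N(A) · γ^ℕ(univ) = P_N(A)`
(`Measure.prod_prod_le`; `γ^ℕ` is a probability measure).  (2) Under `P_N` the velocities are,
conditionally on the positions, independent Gaussians `N(u₀(xᵢ), θ₀(xᵢ) I₃)`; the Chernoff bound for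
the total kinetic energy with the uniform exponential velocity moments of the datum is clause (2) of
the tree theorem `EnergyCurrentTailsPedigree.stub_initialEnergyTails` (`InitialEnergyTails`): there are
`Θ* > 0`, `ē ≥ 0` with `P_N{ē(N+1) + x ≤ ∑ᵢ‖vᵢ‖²} ≤ e^{−x/Θ*}` for all `x ≥ 0`, `0 < σ ≤ 1/2`, `N`,
`Φ`.  Take `x := Θ* M (N+1)`, `K := (ē + Θ* M)/2`, `C := 1`.

Spohn 1991 Part I §2.3 (local equilibrium states); Fernique 1970 (Gaussian exponential moments).
prover-line-stmt-AtomisticToContinuum-11850-c5-0, cycle 6 (stub worker T9).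
-/

noncomputable section

open MeasureTheory Filter Set Topology
open scoped ENNReal

namespace Summit.AtomisticToContinuum.HydrodynamicLimit.Theorems

open Literature.Analysis.FluidPDE Literature.MathematicalPhysics.KineticTheory

/-- **The kinetic energy per particle does not increase along the Lambertian flow and is half the
normalised sum of squared speeds of the datum**: `e_1(Λ_t(z, ξ)) ≤ (N+1)⁻¹ · ½ ∑ᵢ ‖vᵢ‖²`
(`empiricalEnergyField_one_eq`: `e_1 = (N+1)⁻¹ · configEnergy`; `configEnergy_lambertFlow_le`, every
noise sequence, every real `t`). [folklore] -/
theorem empiricalEnergyField_one_lambertFlow_le_sum {N : ℕ} (ε : ℝ)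
    (ξs : ℕ → EuclideanSpace ℝ (Fin 3)) (z : Config (N + 1) (Fin 3) T3) (t : ℝ) :
    empiricalEnergyField (lambertFlow (Torus.geometry (Fin 3)) ε ξs z t) (fun _ => 1) ≤
      (((N + 1 : ℕ) : ℝ))⁻¹ * (2⁻¹ * ∑ i, ‖(z i).2‖ ^ 2) := by
  rw [empiricalEnergyField_one_eq]
  exact mul_le_mul_of_nonneg_left (configEnergy_lambertFlow_le _ _ _) (by positivity)

/-- **T9 · EXPONENTIAL ENERGY TIGHTNESS OF THE LAMBERTIAN GAS, AT EVERY RATE, UNIFORMLY IN TIME**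
(registered stub `stub_energyTightnessLambda` of line `Sketch` of stmt-AtomisticToContinuum-11850):
for continuous profiles, `0 < σ < 1/2` and every rate `M > 0` there are `K` and `C > 0` with
`(P_N ⊗ γ^ℕ){K < e_1(Λ_t p)} ≤ C e^{−M(N+1)}` for all `N`, all flows and all real `t`.  The kinetic
energy does not increase along `Λ` (`empiricalEnergyField_one_lambertFlow_le_sum`), so the event lies
in a cylinder over the time-`0` total-energy event of the datum, whose `P_N ⊗ γ^ℕ`-measure is at most
its `P_N`-measure (`Measure.prod_prod_le`, `γ^ℕ` a probability measure); the Gaussian Chernoff bound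
under the local Gibbs law is clause (2) of `EnergyCurrentTailsPedigree.stub_initialEnergyTails` at
level `x = Θ* M (N+1)`, with `K = (ē + Θ* M)/2`, `C = 1`. [folklore] -/
theorem stub_energyTightnessLambda :
    ∀ (a₀ θ₀ : T3 → ℝ) (u₀ : T3 → V3), Continuous a₀ → Continuous θ₀ → Continuous u₀ →
      (∀ x, 0 < a₀ x) → (∀ x, 0 < θ₀ x) →
      ∀ σ : ℝ, 0 < σ → σ < 2⁻¹ → ∀ M : ℝ, 0 < M → ∃ K C : ℝ, 0 < C ∧
        ∀ (N : ℕ) (Φ : HardSphereFlow (Torus.geometry (Fin 3)) (hsDiameter σ N) (N + 1)) (t : ℝ),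
          ((localGibbsLaw σ a₀ u₀ θ₀ N Φ).prod (lambertNoise (Fin 3)))
              {p | K < empiricalEnergyField (lambertFlow (Torus.geometry (Fin 3)) (hsDiameter σ N) p.2 p.1 t) (fun _ => 1)} ≤
            ENNReal.ofReal (C * Real.exp (-(M * ((N : ℝ) + 1)))) := by
  intro a₀ θ₀ u₀ ha hθ hu ha0 hθ0 σ hσ hσ2 M hM
  obtain ⟨Θs, hΘs, eb, heb, C₀, _hC₀, htails⟩ :=
    EnergyCurrentTailsPedigree.stub_initialEnergyTails a₀ θ₀ u₀ ha hθ hu ha0 hθ0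
  have hσ2' : σ ≤ 1 / 2 := by
    rw [one_div]
    exact hσ2.le
  refine ⟨(eb + Θs * M) / 2, 1, one_pos, fun N Φ t => ?_⟩
  -- the Chernoff level `x = Θ* M (N+1)` of the datum's total-energy event
  set x : ℝ := Θs * (M * ((N : ℝ) + 1)) with hx
  have hN : (0 : ℝ) < (N : ℝ) + 1 := by positivity
  have hx0 : 0 ≤ x := by positivity
  obtain ⟨-, -, h2⟩ := htails σ hσ hσ2' N Φ x hx0
  set A : Set (Config (N + 1) (Fin 3) T3) :=
    {z | eb * ((N : ℝ) + 1) + x ≤ ∑ l : Fin (N + 1), ‖(z l).2‖ ^ 2} with hA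
  -- (1) the event lies in the cylinder over `A`: the energy does not increase along `Λ`
  have hsub : {p : Config (N + 1) (Fin 3) T3 × (ℕ → EuclideanSpace ℝ (Fin 3)) |
      (eb + Θs * M) / 2 < empiricalEnergyField
        (lambertFlow (Torus.geometry (Fin 3)) (hsDiameter σ N) p.2 p.1 t) (fun _ => 1)} ⊆
      A ×ˢ (univ : Set (ℕ → EuclideanSpace ℝ (Fin 3))) := by
    intro p hp
    refine ⟨?_, mem_univ _⟩
    simp only [hA, mem_setOf_eq] at hp ⊢
    have h1 := hp.trans_le (empiricalEnergyField_one_lambertFlow_le_sum (hsDiameter σ N) p.2 p.1 t)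
    have hcast : (((N + 1 : ℕ) : ℝ)) = (N : ℝ) + 1 := by push_cast; ring
    rw [hcast, ← div_eq_inv_mul, lt_div_iff₀ hN] at h1
    have hxe : eb * ((N : ℝ) + 1) + x = 2 * ((eb + Θs * M) / 2 * ((N : ℝ) + 1)) := by
      rw [hx]
      ring
    rw [hxe]
    linarith
  -- (2) product bound and the Gaussian Chernoff bound of the datum
  calc ((localGibbsLaw σ a₀ u₀ θ₀ N Φ).prod (lambertNoise (Fin 3)))
        {p | (eb + Θs * M) / 2 < empiricalEnergyField
          (lambertFlow (Torus.geometry (Fin 3)) (hsDiameter σ N) p.2 p.1 t) (fun _ => 1)}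
      ≤ ((localGibbsLaw σ a₀ u₀ θ₀ N Φ).prod (lambertNoise (Fin 3))) (A ×ˢ univ) :=
        measure_mono hsub
    _ ≤ localGibbsLaw σ a₀ u₀ θ₀ N Φ A * lambertNoise (Fin 3) univ := Measure.prod_prod_le _ _
    _ = localGibbsLaw σ a₀ u₀ θ₀ N Φ A := by rw [measure_univ, mul_one]
    _ ≤ ENNReal.ofReal (Real.exp (-x / Θs)) := h2
    _ = ENNReal.ofReal (1 * Real.exp (-(M * ((N : ℝ) + 1)))) := by
        rw [one_mul, hx, neg_div, mul_comm Θs, mul_div_cancel_right₀ _ hΘs.ne']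

end Summit.AtomisticToContinuum.HydrodynamicLimit.Theorems

end
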